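import Summits.KontsevichZagierPeriods.KontsevichZagierPeriods.Theorems.FiveTermTransfer.Negative.LoadBearing
import Literature.NumberTheory.Transcendental.KZSubcalculusInvariants

/-!
# `FiveTermTransfer` (stmt-KontsevichZagierPeriods-3469) — negative knowledge, part 3: refuted strengthenings

* `not_FiveTermTransferUnsigned`: the orientation sign of the lower half plane in `hB` cannot be
  dropped (witness `x = (3+4i)/5`, `y = x̄`).
* `not_FiveTermTransferByAdditivity`: the five-term element is NOT in the subgroup generated by the
  additivity moves (1a), (1b) alone — invariant: the tree's `KZ.restrictedEval` at a window inside
  `T(2i)` missing the other tetrahedra; witness `(i, 2i)`. A change of variables or a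
  Newton–Leibniz move is NECESSARY (the five standard tetrahedra are not a dissection in situ).
* `not_FiveTermTransferByReparametrisation`: the element is NOT in the subgroup generated by the
  change-of-variables and Newton–Leibniz moves alone — invariant: the tree's `KZ.coeffSum`;
  witness `(i, 2+i)`. An additivity move is NECESSARY.
Together: every derivation uses rule (1) and rule (2) ∨ (3) — the shape of the planned proof
(isometries = rule (2), 2–3 Pachner move = rule (1a)). (cdisprove seat gen 2.) [folklore]
-/

noncomputable section

open Complex MeasureTheory Set
open scoped ComplexConjugate

namespace Summit.KontsevichZagierPeriods.HyperbolicBloch.FiveTermTransferNegative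

open Literature.NumberTheory.Transcendental
open Literature.NumberTheory.Transcendental.KZ
open Summit.KontsevichZagierPeriods.KontsevichZagierPeriods.Theses.HyperbolicBloch (FiveTermTransfer)

/-! ## §4 Refuted strengthenings -/

/-! ### (4a) The sign of the lower half plane cannot be dropped -/

/-- The UNSIGNED class map: `[ρ z]` above, `+[ρ z̄]` below, `0` on the real line. -/
def unsignedClass (ρ : ℂ → IntegralRep 3) (z : ℂ) : FormalRep :=
  if 0 < z.im then KZ.of (ρ z) else if z.im < 0 then KZ.of (ρ (conj z)) else 0

/-- Auxiliary: `unsignedClass_of_im_pos`. [folklore] -/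
theorem unsignedClass_of_im_pos (ρ : ℂ → IntegralRep 3) {z : ℂ} (h : 0 < z.im) :
    unsignedClass ρ z = KZ.of (ρ z) := by
  simp [unsignedClass, h]

/-- Auxiliary: `unsignedClass_of_im_neg`. [folklore] -/
theorem unsignedClass_of_im_neg (ρ : ℂ → IntegralRep 3) {z : ℂ} (h : z.im < 0) :
    unsignedClass ρ z = KZ.of (ρ (conj z)) := by
  simp [unsignedClass, h, not_lt.mpr h.le]

/-- The crux with the sign of the lower-half-plane branch of `hB` flipped to `+`. -/
def FiveTermTransferUnsigned : Prop :=
  ∀ (T : ℂ → Set (Fin 3 → ℝ)), (∀ z, T z = {p | 0 < p 1 ∧ z.re * p 1 < z.im * p 0 ∧ z.im * (p 0 - 1) < (z.re - 1) * p 1 ∧ 0 < p 2 ∧ 0 < z.im * (p 0 ^ 2 + p 1 ^ 2 + p 2 ^ 2 - p 0) + (z.re - Complex.normSq z) * p 1}) →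
    ∀ (ρ : ℂ → IntegralRep 3), (∀ z, IsAlgebraic ℚ z → 0 < z.im → (ρ z).domain = T z ∧ Set.EqOn (ρ z).integrand (fun p => 1 / p 2 ^ 3) (T z)) →
    ∀ (B : ℂ → FormalRep), (∀ z, B z = if 0 < z.im then KZ.of (ρ z) else if z.im < 0 then KZ.of (ρ ((starRingEnd ℂ) z)) else 0) →
    ∀ x y : ℂ, IsAlgebraic ℚ x → IsAlgebraic ℚ y →
    x ≠ 0 → x ≠ 1 → y ≠ 0 → y ≠ 1 → x ≠ y →
    B x - B y + B (y / x) - B ((1 - x⁻¹) / (1 - y⁻¹)) + B ((1 - x) / (1 - y)) ∈ relations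

/-- **The orientation sign is load-bearing.** Witness `x = (3 + 4i)/5`, `y = x̄` (`|x| = 1`):
`B x` and `B y` cancel, `z₄` and `z̅₅` coincide, and the unsigned element collapses to
`[ρ ((−7 + 24i)/25)]`, of value `vol T((−7+24i)/25) > 0`. [folklore] -/
theorem not_FiveTermTransferUnsigned : ¬ FiveTermTransferUnsigned := by
  intro h
  have hx : IsAlgebraic ℚ ((3 + 4 * I) / 5) := isAlgebraic_of_eq_rat (3 / 5) (4 / 5) (by push_cast; ring)
  have hy : IsAlgebraic ℚ ((3 - 4 * I) / 5) :=
    isAlgebraic_of_eq_rat (3 / 5) (-4 / 5) (by push_cast; ring)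
  have hmem := h idealTetrahedron (fun _ => rfl) ρ₀ isStandardOn_ρ₀ (unsignedClass ρ₀) (fun _ => rfl)
    ((3 + 4 * I) / 5) ((3 - 4 * I) / 5) hx hy (by intro e; have := congrArg Complex.im e; norm_num at this)
    (by intro e; have := congrArg Complex.im e; norm_num at this)
    (by intro e; have := congrArg Complex.im e; norm_num at this)
    (by intro e; have := congrArg Complex.im e; norm_num at this)
    (by intro e; have := congrArg Complex.im e; norm_num at this)
  change fiveTerm (unsignedClass ρ₀) ((3 + 4 * I) / 5) ((3 - 4 * I) / 5) ∈ relations at hmem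
  have e3 : (3 - 4 * I) / 5 / ((3 + 4 * I) / 5) = (-7 - 24 * I) / 25 := by
    apply Complex.ext <;> simp [Complex.div_re, Complex.div_im, Complex.normSq_apply] <;> norm_num
  have e4 : (1 - ((3 + 4 * I) / 5)⁻¹) / (1 - ((3 - 4 * I) / 5)⁻¹) = (-3 + 4 * I) / 5 := by
    apply Complex.ext <;> simp [Complex.div_re, Complex.div_im, Complex.normSq_apply] <;> norm_num
  have e5 : (1 - (3 + 4 * I) / 5) / (1 - (3 - 4 * I) / 5) = (-3 - 4 * I) / 5 := by
    apply Complex.ext <;> simp [Complex.div_re, Complex.div_im, Complex.normSq_apply] <;> norm_num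
  have c2 : conj ((3 - 4 * I) / 5) = (3 + 4 * I) / 5 :=
    Complex.ext (by rw [Complex.conj_re]; norm_num) (by rw [Complex.conj_im]; norm_num)
  have c3 : conj ((-7 - 24 * I) / 25) = (-7 + 24 * I) / 25 :=
    Complex.ext (by rw [Complex.conj_re]; norm_num) (by rw [Complex.conj_im]; norm_num)
  have c5 : conj ((-3 - 4 * I) / 5) = (-3 + 4 * I) / 5 :=
    Complex.ext (by rw [Complex.conj_re]; norm_num) (by rw [Complex.conj_im]; norm_num)
  have key : fiveTerm (unsignedClass ρ₀) ((3 + 4 * I) / 5) ((3 - 4 * I) / 5) =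
      KZ.of (ρ₀ ((-7 + 24 * I) / 25)) := by
    unfold fiveTerm
    rw [e3, e4, e5, unsignedClass_of_im_pos ρ₀ (z := (3 + 4 * I) / 5) (by norm_num),
      unsignedClass_of_im_neg ρ₀ (z := (3 - 4 * I) / 5) (by norm_num), c2,
      unsignedClass_of_im_neg ρ₀ (z := (-7 - 24 * I) / 25) (by norm_num), c3,
      unsignedClass_of_im_pos ρ₀ (z := (-3 + 4 * I) / 5) (by norm_num),
      unsignedClass_of_im_neg ρ₀ (z := (-3 - 4 * I) / 5) (by norm_num), c5]
    abel
  refine not_mem_relations_of_eval_ne_zero ?_ hmem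
  rw [key, eval_of]
  exact (value_ρ₀_pos _).ne'

/-! ### (4b) The additivity moves (1a) + (1b) alone do not suffice

Invariant: evaluation LOCALISED to a window, `[r] ↦ ∫_{r.domain ∩ U} r.integrand` (the tree's
`KZ.restrictedEval`, `KZSubcalculusInvariants.lean`), is additive over the two additivity moves (but
of course not over changes of variables). At the calibration
instance `(x, y) = (i, 2i)` the element is `[T i] − [T 2i] − [T((6+2i)/5)] + [T((3+i)/5)]`
(four standard tetrahedra in situ); the window `(0, 1/5) × (1, 3/2) × (3, ∞)` lies inside `T(2i)`
and misses the other three (`Im w ≤ 1 ⇒ T(w) ⊆ {p 1 < 1}`), so the localised value is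
`−∫_window t⁻³ < 0`. -/

/-- One-variable factors of the window `(0, 1/5) × (1, 3/2) × (3, ∞)`. -/
def wInt : ℕ → Set ℝ
  | 0 => Ioo 0 (1 / 5)
  | 1 => Ioo 1 (3 / 2)
  | 2 => Ioi 3
  | _ => univ

/-- Auxiliary: `measurableSet_wInt`. [folklore] -/
theorem measurableSet_wInt : ∀ k, MeasurableSet (wInt k)
  | 0 => measurableSet_Ioo
  | 1 => measurableSet_Ioo
  | 2 => measurableSet_Ioi
  | _ + 3 => MeasurableSet.univ

/-- Auxiliary: `isOpen_wInt`. [folklore] -/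
theorem isOpen_wInt : ∀ k, IsOpen (wInt k)
  | 0 => isOpen_Ioo
  | 1 => isOpen_Ioo
  | 2 => isOpen_Ioi
  | _ + 3 => isOpen_univ

/-- The window family (in dimension `3`: the box `(0, 1/5) × (1, 3/2) × (3, ∞)`). -/
def W (n : ℕ) : Set (Fin n → ℝ) := Set.pi univ fun i => wInt i.val

/-- Auxiliary: `measurableSet_W`. [folklore] -/
theorem measurableSet_W (n : ℕ) : MeasurableSet (W n) :=
  MeasurableSet.univ_pi fun i => measurableSet_wInt i.val

/-- Auxiliary: `isOpen_W_three`. [folklore] -/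
theorem isOpen_W_three : IsOpen (W 3) :=
  isOpen_set_pi finite_univ fun i _ => isOpen_wInt i.val

/-- Auxiliary: `mem_W_three`. [folklore] -/
theorem mem_W_three {p : Fin 3 → ℝ} :
    p ∈ W 3 ↔ (0 < p 0 ∧ p 0 < 1 / 5) ∧ (1 < p 1 ∧ p 1 < 3 / 2) ∧ 3 < p 2 := by
  simp [W, wInt, Fin.forall_fin_succ]

/-- The window lies inside `T(2i)`. -/
theorem W_three_subset : W 3 ⊆ idealTetrahedron (2 * I) := by
  intro p hp
  obtain ⟨⟨h0, h0'⟩, ⟨h1, h1'⟩, h2⟩ := mem_W_three.mp hp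
  rw [mem_idealTetrahedron_iff]
  norm_num
  refine ⟨by linarith, h0, by linarith, by linarith, by nlinarith⟩

/-- A tetrahedron `T(w)` with `Im w ≤ 1` misses the window: inside the triangle `(0, 1, w)` one has
`p 1 < Im w` (sum of the two slanted edge inequalities). -/
theorem idealTetrahedron_inter_W_three {w : ℂ} (hw : w.im ≤ 1) : idealTetrahedron w ∩ W 3 = ∅ := by
  ext p
  simp only [mem_inter_iff, mem_empty_iff_false, iff_false, not_and]
  intro hT hW
  obtain ⟨-, ⟨h1, -⟩, -⟩ := mem_W_three.mp hW
  have e1 := hT.2.1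
  have e2 := hT.2.2.1
  nlinarith

/-- The crux with `KZ.relations` replaced by the subgroup generated by the additivity moves alone. -/
def FiveTermTransferByAdditivity : Prop :=
  ∀ (T : ℂ → Set (Fin 3 → ℝ)), (∀ z, T z = {p | 0 < p 1 ∧ z.re * p 1 < z.im * p 0 ∧ z.im * (p 0 - 1) < (z.re - 1) * p 1 ∧ 0 < p 2 ∧ 0 < z.im * (p 0 ^ 2 + p 1 ^ 2 + p 2 ^ 2 - p 0) + (z.re - Complex.normSq z) * p 1}) →
    ∀ (ρ : ℂ → IntegralRep 3), (∀ z, IsAlgebraic ℚ z → 0 < z.im → (ρ z).domain = T z ∧ Set.EqOn (ρ z).integrand (fun p => 1 / p 2 ^ 3) (T z)) →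
    ∀ (B : ℂ → FormalRep), (∀ z, B z = if 0 < z.im then KZ.of (ρ z) else if z.im < 0 then -KZ.of (ρ ((starRingEnd ℂ) z)) else 0) →
    ∀ x y : ℂ, IsAlgebraic ℚ x → IsAlgebraic ℚ y →
    x ≠ 0 → x ≠ 1 → y ≠ 0 → y ≠ 1 → x ≠ y →
    B x - B y + B (y / x) - B ((1 - x⁻¹) / (1 - y⁻¹)) + B ((1 - x) / (1 - y)) ∈ AddSubgroup.closure (Literature.NumberTheory.Transcendental.KZ.domainAddRel ∪ Literature.NumberTheory.Transcendental.KZ.integrandAddRel)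

/-- **Rule (2) or rule (3) is necessary**: the five-term element is not in the subgroup generated
by the additivity moves (1a), (1b). Witness `(x, y) = (i, 2i)`, invariant `KZ.restrictedEval W`. [folklore] -/
theorem not_FiveTermTransferByAdditivity : ¬ FiveTermTransferByAdditivity := by
  intro h
  have hy : IsAlgebraic ℚ (2 * I) := isAlgebraic_of_eq_rat 0 2 (by push_cast; ring)
  have h35 : IsAlgebraic ℚ ((3 + I) / 5) := isAlgebraic_of_eq_rat (3 / 5) (1 / 5) (by push_cast; ring)
  have h62 : IsAlgebraic ℚ ((6 + 2 * I) / 5) :=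
    isAlgebraic_of_eq_rat (6 / 5) (2 / 5) (by push_cast; ring)
  have hmem := h idealTetrahedron (fun _ => rfl) ρ₀ isStandardOn_ρ₀ (signedClass ρ₀) (fun _ => rfl)
    I (2 * I) (isAlgebraic_of_eq_rat 0 1 (by push_cast; ring)) hy I_ne_zero (by intro e; simpa using congrArg Complex.im e)
    (by intro e; have := congrArg Complex.im e; norm_num at this)
    (by intro e; have := congrArg Complex.im e; norm_num at this)
    (by intro e; have := congrArg Complex.im e; norm_num at this)
  change fiveTerm (signedClass ρ₀) I (2 * I) ∈ _ at hmem
  have e3 : 2 * I / I = 2 := by simp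
  have e4 : (1 - I⁻¹) / (1 - (2 * I)⁻¹) = (6 + 2 * I) / 5 := by
    apply Complex.ext <;> simp [Complex.div_re, Complex.div_im, Complex.normSq_apply] <;> norm_num
  have e5 : (1 - I) / (1 - 2 * I) = (3 + I) / 5 := by
    apply Complex.ext <;> simp [Complex.div_re, Complex.div_im, Complex.normSq_apply] <;> norm_num
  have key : fiveTerm (signedClass ρ₀) I (2 * I) = KZ.of (ρ₀ I) - KZ.of (ρ₀ (2 * I))
      - KZ.of (ρ₀ ((6 + 2 * I) / 5)) + KZ.of (ρ₀ ((3 + I) / 5)) := by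
    unfold fiveTerm
    rw [e3, e4, e5, signedClass_of_im_pos ρ₀ (z := I) (by norm_num),
      signedClass_of_im_pos ρ₀ (z := 2 * I) (by norm_num), signedClass_of_im_zero ρ₀ (z := 2) (by norm_num),
      signedClass_of_im_pos ρ₀ (z := (6 + 2 * I) / 5) (by norm_num),
      signedClass_of_im_pos ρ₀ (z := (3 + I) / 5) (by norm_num)]
    abel
  have hzero : restrictedEval W (fiveTerm (signedClass ρ₀) I (2 * I)) = 0 :=
    closure_add_le_ker_restrictedEval W measurableSet_W hmem
  rw [key] at hzero
  simp only [map_add, map_sub, restrictedEval_of] at hzero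
  rw [show ρ₀ I = idealTetrahedronRep I (isAlgebraic_of_eq_rat 0 1 (by push_cast; ring)) (by norm_num) from stdRep_of_pos _ _ _,
    show ρ₀ (2 * I) = idealTetrahedronRep (2 * I) hy (by norm_num) from stdRep_of_pos _ _ _,
    show ρ₀ ((6 + 2 * I) / 5) = idealTetrahedronRep _ h62 (by norm_num) from stdRep_of_pos _ _ _,
    show ρ₀ ((3 + I) / 5) = idealTetrahedronRep _ h35 (by norm_num) from stdRep_of_pos _ _ _] at hzero
  simp only [domain_idealTetrahedronRep, integrand_idealTetrahedronRep] at hzero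
  rw [idealTetrahedron_inter_W_three (w := I) (by norm_num),
    idealTetrahedron_inter_W_three (w := (6 + 2 * I) / 5) (by norm_num),
    idealTetrahedron_inter_W_three (w := (3 + I) / 5) (by norm_num),
    inter_eq_right.mpr W_three_subset] at hzero
  simp only [Measure.restrict_empty, integral_zero_measure, zero_sub, sub_zero, add_zero] at hzero
  -- hzero : -∫ p in W 3, 1 / p 2 ^ 3 = 0
  have hpos : 0 < ∫ p in W 3, (1 : ℝ) / p 2 ^ 3 := by
    rw [setIntegral_pos_iff_support_of_nonneg_ae]
    · have hsub : W 3 ⊆ Function.support (fun p : Fin 3 → ℝ => 1 / p 2 ^ 3) ∩ W 3 := fun p hp =>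
        ⟨by
          rw [Function.mem_support]
          exact one_div_ne_zero (pow_ne_zero 3 (by linarith [(mem_W_three.mp hp).2.2])), hp⟩
      refine lt_of_lt_of_le (isOpen_W_three.measure_pos volume ⟨![1 / 10, 5 / 4, 4], ?_⟩)
        (measure_mono hsub)
      rw [mem_W_three]
      simp only [Matrix.cons_val_zero, Matrix.cons_val_one, Matrix.cons_val]
      norm_num
    · rw [Filter.EventuallyLE, ae_restrict_iff' (measurableSet_W 3)]
      exact Filter.Eventually.of_forall fun p hp => by
        have := (mem_W_three.mp hp).2.2
        positivity
    · exact (integrableOn_one_div_cube_idealTetrahedron (z := 2 * I) (by norm_num)).mono_set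
        W_three_subset
  linarith

/-! ### (4c) Rules (2) + (3) alone do not suffice

Invariant: the augmentation `[r] ↦ 1` (the tree's `KZ.coeffSum`), which kills `[r] − [r']` (every
change-of-variables and Newton–Leibniz generator) but takes the value `Σ εᵢ = ±1` on the element of
a bipyramid configuration. -/

/-- The crux with `KZ.relations` replaced by the subgroup generated by rules (2) and (3) alone. -/
def FiveTermTransferByReparametrisation : Prop :=
  ∀ (T : ℂ → Set (Fin 3 → ℝ)), (∀ z, T z = {p | 0 < p 1 ∧ z.re * p 1 < z.im * p 0 ∧ z.im * (p 0 - 1) < (z.re - 1) * p 1 ∧ 0 < p 2 ∧ 0 < z.im * (p 0 ^ 2 + p 1 ^ 2 + p 2 ^ 2 - p 0) + (z.re - Complex.normSq z) * p 1}) →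
    ∀ (ρ : ℂ → IntegralRep 3), (∀ z, IsAlgebraic ℚ z → 0 < z.im → (ρ z).domain = T z ∧ Set.EqOn (ρ z).integrand (fun p => 1 / p 2 ^ 3) (T z)) →
    ∀ (B : ℂ → FormalRep), (∀ z, B z = if 0 < z.im then KZ.of (ρ z) else if z.im < 0 then -KZ.of (ρ ((starRingEnd ℂ) z)) else 0) →
    ∀ x y : ℂ, IsAlgebraic ℚ x → IsAlgebraic ℚ y →
    x ≠ 0 → x ≠ 1 → y ≠ 0 → y ≠ 1 → x ≠ y →
    B x - B y + B (y / x) - B ((1 - x⁻¹) / (1 - y⁻¹)) + B ((1 - x) / (1 - y)) ∈ AddSubgroup.closure (Literature.NumberTheory.Transcendental.KZ.changeOfVariablesRel ∪ Literature.NumberTheory.Transcendental.KZ.newtonLeibnizRel)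

/-- **Rule (1) is necessary**: the five-term element is not in the subgroup generated by the
change-of-variables and Newton–Leibniz moves. Witness `(x, y) = (i, 2 + i)` (bipyramid
configuration, `Σ εᵢ = −1`), invariant `KZ.coeffSum`. [folklore] -/
theorem not_FiveTermTransferByReparametrisation : ¬ FiveTermTransferByReparametrisation := by
  intro h
  have hy : IsAlgebraic ℚ (2 + I) := isAlgebraic_of_eq_rat 2 1 (by push_cast; ring)
  have hmem := h idealTetrahedron (fun _ => rfl) ρ₀ isStandardOn_ρ₀ (signedClass ρ₀) (fun _ => rfl)
    I (2 + I) (isAlgebraic_of_eq_rat 0 1 (by push_cast; ring)) hy I_ne_zero (by intro e; simpa using congrArg Complex.im e)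
    (by intro e; simpa using congrArg Complex.im e) (by intro e; simpa using congrArg Complex.im e)
    (by intro e; simpa using congrArg Complex.re e)
  change fiveTerm (signedClass ρ₀) I (2 + I) ∈ _ at hmem
  have e3 : (2 + I) / I = 1 - 2 * I := by
    apply Complex.ext <;> simp
  have e4 : (1 - I⁻¹) / (1 - (2 + I)⁻¹) = 2 + I := by
    apply Complex.ext <;> simp [Complex.div_re, Complex.div_im, Complex.normSq_apply] <;> norm_num
  have e5 : (1 - I) / (1 - (2 + I)) = I := by
    apply Complex.ext <;> simp [Complex.div_re, Complex.div_im, Complex.normSq_apply] <;> norm_num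
  have key : coeffSum (fiveTerm (signedClass ρ₀) I (2 + I)) = -1 := by
    unfold fiveTerm
    rw [e3, e4, e5, signedClass_of_im_pos ρ₀ (z := I) (by norm_num),
      signedClass_of_im_pos ρ₀ (z := 2 + I) (by norm_num),
      signedClass_of_im_neg ρ₀ (z := 1 - 2 * I) (by norm_num)]
    simp only [map_add, map_sub, map_neg, coeffSum_of]
    norm_num
  have h0 : coeffSum (fiveTerm (signedClass ρ₀) I (2 + I)) = 0 := closure_cov_nl_le_ker_coeffSum hmem
  rw [key] at h0
  norm_num at h0



end Summit.KontsevichZagierPeriods.HyperbolicBloch.FiveTermTransferNegative
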